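import Literature.MathematicalPhysics.QuantumLattice.DuhamelTwoPoint
import HarnessLib

/-!
# Peierls' inequality for orthonormal families: `Σ_I e^{-β⟨Ψ_I, H Ψ_I⟩} ≤ tr e^{-βH}`

Topic `Literature/MathematicalPhysics/QuantumLattice` (thermal toolkit, next to `DuhamelTwoPoint.lean`,
whose `Matrix.IsHermitian.sum_exp_apply_le_trace_exp` is Peierls' inequality for the standard BASIS
`Σᵢ e^{Mᵢᵢ} ≤ tr e^{M}`). This file proves the general form for an arbitrary ORTHONORMAL FAMILY (not
necessarily a basis, not necessarily eigenvectors) and its compression-to-a-sector variant — the producer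
of LOWER bounds on partition functions (upper bounds on free energies) from trial vectors, in particular
from graded tensor products of cluster eigenvectors (the finite-temperature cluster variational principle:
`Z_Λ ≥ Π Z_cluster`). For a Hermitian matrix `H` on a finite index type, all PROVED:

* `IsHermitian.exp_neg_mul_rayleigh_le` — Jensen for one unit vector:
  `e^{-β Re⟨v, Hv⟩} ≤ Re⟨v, e^{-βH} v⟩` (spectral decomposition of `v`, convexity of `exp`);
* `PosSemidef.sum_re_rayleigh_le_trace` — for `M ≥ 0` and an orthonormal family `(v_I)`,
  `Σ_I Re⟨v_I, M v_I⟩ ≤ Re tr M` (the complementary projection `Q = 1 − Σ_I v_I v_I†` gives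
  `tr M − Σ_I ⟨v_I, M v_I⟩ = tr (Q M Q) ≥ 0`);
* `IsHermitian.sum_exp_neg_mul_rayleigh_le_partitionFn` — **Peierls' inequality for orthonormal
  families**: `Σ_I e^{-β Re⟨v_I, H v_I⟩} ≤ Re Z_β(H)`, and its logarithmic form;
* `IsHermitian.sum_exp_neg_mul_rayleigh_le_partitionFn_submatrix` — the same for an orthonormal family of
  vectors SUPPORTED IN A COORDINATE SECTOR `p`, against the partition function of the compression
  `H.submatrix val val` to that sector (canonical / fixed-particle-number partition functions).

Sources: R. Peierls, Phys. Rev. 54 (1938) 918 (the inequality); textbook forms: B. Simon, *The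
Statistical Mechanics of Lattice Gases* I (1993) §II.8; D. Ruelle, *Statistical Mechanics* (1969)
§2.5 (convexity inequalities for `tr e^{A}`). We cite the statement as printed in
[cite: Ruelle1969, §2.5–2.6] and [cite: Simon1993, §II.8]. Tree search: `lean search 'peierls|Peierls'` —
only the basis form `sum_exp_apply_le_trace_exp` and the Peierls–Bogoliubov inequality
(`DuhamelTwoPoint`); `lean search 'orthonormal.*trace|trace.*orthonormal'` in `QuantumLattice` — nothing.
-/

noncomputable section

open scoped Matrix.Norms.L2Operator ComplexOrder
open Finset

namespace Matrix

variable {n : Type*} [Fintype n] [DecidableEq n]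

/-! ### Rayleigh quotients in an eigenbasis -/

omit [DecidableEq n] in
/-- `⟨v, (U diag(d) U⋆) v⟩ = Σ_k d_k ‖(U⋆v)_k‖²` (as a real number cast to `ℂ`): a Hermitian form in the
coordinates of a diagonalising basis (Rayleigh quotient in eigen-coordinates).
[cite: HornJohnson2013, §4.2 Theorem 4.2.2] -/
theorem star_dotProduct_conj_diagonal_mulVec [DecidableEq n] (U : Matrix n n ℂ) (d : n → ℝ)
    (v : n → ℂ) :
    star v ⬝ᵥ ((U * diagonal (fun k => (d k : ℂ)) * star U) *ᵥ v) =
      ((∑ k, d k * ‖(star U *ᵥ v) k‖ ^ 2 : ℝ) : ℂ) := by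
  set w : n → ℂ := star U *ᵥ v with hw
  have hsw : star w = star v ᵥ* U := by
    rw [hw, star_mulVec, star_eq_conjTranspose, conjTranspose_conjTranspose]
  rw [← mulVec_mulVec, ← mulVec_mulVec, ← hw, dotProduct_mulVec, ← hsw, dotProduct,
    Complex.ofReal_sum]
  refine sum_congr rfl fun k _ => ?_
  rw [mulVec_diagonal, Pi.star_apply, ← mul_assoc, mul_comm (star (w k)), mul_assoc,
    Complex.star_def, mul_comm ((starRingEnd ℂ) (w k)), Complex.mul_conj, Complex.normSq_eq_norm_sq]
  push_cast
  ring

omit [DecidableEq n] in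
/-- A unitary change of basis preserves the norm: `Σ_k ‖(U⋆v)_k‖² = Re⟨v, v⟩`.
[cite: HornJohnson2013, §2.1 Theorem 2.1.4] -/
theorem sum_norm_sq_star_unitary_mulVec [DecidableEq n] {U : Matrix n n ℂ}
    (hU : U ∈ unitary (Matrix n n ℂ)) (v : n → ℂ) :
    ∑ k, ‖(star U *ᵥ v) k‖ ^ 2 = (star v ⬝ᵥ v).re := by
  have h := star_dotProduct_conj_diagonal_mulVec U (fun _ => (1 : ℝ)) v
  have h1 : diagonal (fun _ : n => ((1 : ℝ) : ℂ)) = 1 := by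
    rw [Complex.ofReal_one]; rfl
  rw [h1, Matrix.mul_one, Unitary.mul_star_self_of_mem hU, one_mulVec] at h
  rw [h, Complex.ofReal_re]
  simp

/-! ### Jensen for one unit vector -/

variable {H : Matrix n n ℂ}

/-- **Peierls–Jensen for a unit vector**: `e^{-β Re⟨v, Hv⟩} ≤ Re⟨v, e^{-βH} v⟩` for Hermitian `H`,
real `β` and `⟨v, v⟩ = 1` (in an eigenbasis both sides are averages over the probability vector
`‖(U⋆v)_k‖²`; convexity of `exp`). [cite: Ruelle1969, §2.5–2.6] -/
theorem IsHermitian.exp_neg_mul_rayleigh_le (hH : H.IsHermitian) (β : ℝ) {v : n → ℂ}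
    (hv : star v ⬝ᵥ v = 1) :
    Real.exp (-(β * (star v ⬝ᵥ (H *ᵥ v)).re)) ≤ (star v ⬝ᵥ (gibbsWeight β H *ᵥ v)).re := by
  set U : Matrix n n ℂ := (hH.eigenvectorUnitary : Matrix n n ℂ) with hU
  have hUu : U ∈ unitary (Matrix n n ℂ) := hH.eigenvectorUnitary.prop
  set p : n → ℝ := fun k => ‖(star U *ᵥ v) k‖ ^ 2 with hp
  have hp0 : ∀ k, 0 ≤ p k := fun k => sq_nonneg _
  have hp1 : ∑ k, p k = 1 := by
    rw [hp]
    simp only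
    rw [sum_norm_sq_star_unitary_mulVec hUu, hv, Complex.one_re]
  have hE : (star v ⬝ᵥ (H *ᵥ v)).re = ∑ k, p k * hH.eigenvalues k := by
    conv_lhs => rw [hH.eq_conj_diagonal, ← hU, star_dotProduct_conj_diagonal_mulVec, Complex.ofReal_re]
    exact sum_congr rfl fun k _ => by rw [hp]; ring
  have hW : (star v ⬝ᵥ (gibbsWeight β H *ᵥ v)).re =
      ∑ k, p k * Real.exp (-(β * hH.eigenvalues k)) := by
    rw [hH.gibbsWeight_eq β, ← hU, star_dotProduct_conj_diagonal_mulVec, Complex.ofReal_re]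
    exact sum_congr rfl fun k _ => by rw [hp]; ring
  rw [hE, hW]
  have hJ := (convexOn_exp).map_sum_le (t := (univ : Finset n)) (w := p)
    (p := fun k => -(β * hH.eigenvalues k)) (fun k _ => hp0 k) hp1 (fun k _ => Set.mem_univ _)
  simp only [smul_eq_mul] at hJ
  have hlin : -(β * ∑ k, p k * hH.eigenvalues k) = ∑ k, p k * -(β * hH.eigenvalues k) := by
    rw [mul_sum, ← sum_neg_distrib]
    exact sum_congr rfl fun k _ => by ring
  rw [hlin]
  exact hJ

/-! ### Orthonormal families under a positive semidefinite matrix -/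

omit [DecidableEq n] in
/-- **Bessel-type trace inequality**: for `M ≥ 0` and an orthonormal family `(v_I)_{I ∈ ι}`,
`Σ_I Re⟨v_I, M v_I⟩ ≤ Re tr M`. Proof: with the projection `P = Σ_I v_I v_I†` and `Q = 1 − P = Q† = Q²`,
`tr M − Σ_I ⟨v_I, M v_I⟩ = tr(MQ) = tr(Q† M Q) ≥ 0`. [cite: Simon1993, §II.8] -/
theorem PosSemidef.sum_re_rayleigh_le_trace [DecidableEq n] {M : Matrix n n ℂ} (hM : M.PosSemidef)
    {ι : Type*} [Fintype ι] [DecidableEq ι] {v : ι → n → ℂ}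
    (hv : ∀ i j, star (v i) ⬝ᵥ v j = if i = j then 1 else 0) :
    ∑ i, (star (v i) ⬝ᵥ (M *ᵥ v i)).re ≤ M.trace.re := by
  set P : Matrix n n ℂ := ∑ i, vecMulVec (v i) (star (v i)) with hP
  -- `tr (M P) = Σ_I ⟨v_I, M v_I⟩`
  have htr : (M * P).trace = ∑ i, star (v i) ⬝ᵥ (M *ᵥ v i) := by
    rw [hP, mul_sum, trace_sum]
    refine sum_congr rfl fun i _ => ?_
    rw [mul_vecMulVec, trace_vecMulVec, dotProduct_comm]
  -- `P† = P`, `P² = P`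
  have hPh : Pᴴ = P := by
    rw [hP, conjTranspose_sum]
    exact sum_congr rfl fun i _ => by rw [conjTranspose_vecMulVec, star_star]
  have hPP : P * P = P := by
    rw [hP, sum_mul]
    refine sum_congr rfl fun i _ => ?_
    rw [mul_sum]
    have : ∀ j, vecMulVec (v i) (star (v i)) * vecMulVec (v j) (star (v j)) =
        if i = j then vecMulVec (v i) (star (v i)) else 0 := by
      intro j
      rw [vecMulVec_mul_vecMulVec, hv i j]
      split_ifs with hij
      · subst hij; rw [one_smul]
      · rw [zero_smul]
        ext a b
        simp [vecMulVec_apply]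
    simp only [this, sum_ite_eq, mem_univ, if_true]
  -- `Q = 1 - P`: `tr M - tr (M P) = tr (Q† M Q) ≥ 0`
  set Q : Matrix n n ℂ := 1 - P with hQ
  have hQh : Qᴴ = Q := by rw [hQ, conjTranspose_sub, conjTranspose_one, hPh]
  have hQQ : Q * Q = Q := by
    rw [hQ, sub_mul, mul_sub, mul_sub, Matrix.one_mul, Matrix.mul_one, Matrix.one_mul, hPP, sub_self,
      sub_zero]
  have hdiff : M.trace - (M * P).trace = (Qᴴ * M * Q).trace := by
    rw [hQh, trace_mul_cycle, hQQ, hQ, sub_mul, Matrix.one_mul, trace_sub, trace_mul_comm P M]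
  have hpsd : (Qᴴ * M * Q).PosSemidef := hM.conjTranspose_mul_mul_same Q
  have h0 : 0 ≤ (Qᴴ * M * Q).trace := hpsd.trace_nonneg
  have hre : 0 ≤ ((Qᴴ * M * Q).trace).re := (Complex.nonneg_iff.mp h0).1
  rw [← hdiff, Complex.sub_re, htr, Complex.re_sum] at hre
  linarith

/-! ### Peierls' inequality for orthonormal families -/

/-- **Peierls' inequality for an orthonormal family**: for Hermitian `H`, real `β` and orthonormal
`(v_I)_{I ∈ ι}`, `Σ_I e^{-β Re⟨v_I, H v_I⟩} ≤ Re Z_β(H) = Re tr e^{-βH}`. Equality holds for an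
orthonormal eigenbasis. [cite: Ruelle1969, §2.5–2.6] [cite: Simon1993, §II.8] -/
theorem IsHermitian.sum_exp_neg_mul_rayleigh_le_partitionFn (hH : H.IsHermitian) (β : ℝ)
    {ι : Type*} [Fintype ι] [DecidableEq ι] {v : ι → n → ℂ}
    (hv : ∀ i j, star (v i) ⬝ᵥ v j = if i = j then 1 else 0) :
    ∑ i, Real.exp (-(β * (star (v i) ⬝ᵥ (H *ᵥ v i)).re)) ≤ (partitionFn β H).re := by
  have h1 : ∑ i, Real.exp (-(β * (star (v i) ⬝ᵥ (H *ᵥ v i)).re)) ≤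
      ∑ i, (star (v i) ⬝ᵥ (gibbsWeight β H *ᵥ v i)).re :=
    sum_le_sum fun i _ => hH.exp_neg_mul_rayleigh_le β (by rw [hv i i, if_pos rfl])
  refine h1.trans ?_
  rw [partitionFn]
  exact (posDef_gibbsWeight β hH).posSemidef.sum_re_rayleigh_le_trace hv

/-- **Peierls' inequality, logarithmic form**: for a nonempty orthonormal family,
`log Σ_I e^{-β Re⟨v_I, H v_I⟩} ≤ log Re Z_β(H)` — an explicit LOWER bound on the log-partition
function (upper bound on the free energy) from trial vectors. [cite: Ruelle1969, §2.5–2.6] -/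
theorem IsHermitian.log_sum_exp_neg_mul_rayleigh_le (hH : H.IsHermitian) (β : ℝ)
    {ι : Type*} [Fintype ι] [DecidableEq ι] [Nonempty ι] {v : ι → n → ℂ}
    (hv : ∀ i j, star (v i) ⬝ᵥ v j = if i = j then 1 else 0) :
    Real.log (∑ i, Real.exp (-(β * (star (v i) ⬝ᵥ (H *ᵥ v i)).re))) ≤
      Real.log (partitionFn β H).re :=
  Real.log_le_log (sum_pos (fun _ _ => Real.exp_pos _) univ_nonempty)
    (hH.sum_exp_neg_mul_rayleigh_le_partitionFn β hv)

/-! ### Compression to a coordinate sector -/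

section Sector

variable {m : Type*} [Fintype m] [DecidableEq m] (p : m → Prop) [DecidablePred p]

omit [DecidableEq m] in
/-- A sum of a function vanishing off the sector `p` is the sum over the sector. [folklore] -/
private theorem sum_eq_sum_subtype_of_support {f : m → ℂ} (hf : ∀ x, ¬ p x → f x = 0) :
    ∑ x, f x = ∑ x : Subtype p, f x := by
  rw [← Finset.sum_subtype (Finset.univ.filter p) (by simp), Finset.sum_filter_of_ne]
  intro x _ hx
  by_contra hpx
  exact hx (hf x hpx)

omit [DecidableEq m] in
/-- Inner products of vectors supported in the coordinate sector `p` are computed in the sector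
(restriction to an invariant/coordinate subspace). [cite: Tasaki2020, §2.2] -/
theorem star_dotProduct_eq_subtype {v w : m → ℂ} (hw : ∀ x, ¬ p x → w x = 0) :
    star v ⬝ᵥ w = star (fun x : Subtype p => v x) ⬝ᵥ fun x : Subtype p => w x := by
  rw [dotProduct, dotProduct, sum_eq_sum_subtype_of_support p]
  · rfl
  · intro x hx
    rw [Pi.star_apply, hw x hx, mul_zero]

omit [DecidableEq m] in
/-- Rayleigh quotients (matrix elements) of vectors supported in the coordinate sector `p` are those
of the compression `A.submatrix val val` (spectral theory in a sector). [cite: Tasaki2020, §2.2] -/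
theorem star_dotProduct_mulVec_eq_submatrix (A : Matrix m m ℂ) {v w : m → ℂ}
    (hv : ∀ x, ¬ p x → v x = 0) (hw : ∀ x, ¬ p x → w x = 0) :
    star v ⬝ᵥ (A *ᵥ w) =
      star (fun x : Subtype p => v x) ⬝ᵥ
        (A.submatrix Subtype.val Subtype.val *ᵥ fun x : Subtype p => w x) := by
  rw [dotProduct, dotProduct, sum_eq_sum_subtype_of_support p]
  · refine sum_congr rfl fun x _ => ?_
    rw [Pi.star_apply, Pi.star_apply, mulVec, mulVec, dotProduct, dotProduct,
      sum_eq_sum_subtype_of_support p]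
    · rfl
    · intro y hy
      rw [hw y hy, mul_zero]
  · intro x hx
    rw [Pi.star_apply, hv x hx, star_zero, zero_mul]

/-- **Peierls' inequality in a sector**: for Hermitian `A`, real `β` and an orthonormal family
`(v_I)` of vectors supported in the coordinate sector `p`,
`Σ_I e^{-β Re⟨v_I, A v_I⟩} ≤ Re Z_β(A|_p)` with `A|_p = A.submatrix val val` the compression to the
sector (e.g. a fixed-particle-number / canonical partition function). [cite: Ruelle1969, §2.5–2.6]
[cite: Simon1993, §II.8] -/
theorem IsHermitian.sum_exp_neg_mul_rayleigh_le_partitionFn_submatrix {A : Matrix m m ℂ}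
    (hA : A.IsHermitian) (β : ℝ) {ι : Type*} [Fintype ι] [DecidableEq ι] {v : ι → m → ℂ}
    (hv : ∀ i j, star (v i) ⬝ᵥ v j = if i = j then 1 else 0) (hsupp : ∀ i x, ¬ p x → v i x = 0) :
    ∑ i, Real.exp (-(β * (star (v i) ⬝ᵥ (A *ᵥ v i)).re)) ≤
      (partitionFn β (A.submatrix (Subtype.val : Subtype p → m) Subtype.val)).re := by
  have hAs : (A.submatrix (Subtype.val : Subtype p → m) Subtype.val).IsHermitian :=
    hA.submatrix Subtype.val
  have hw : ∀ i j, star (fun x : Subtype p => v i x) ⬝ᵥ (fun x : Subtype p => v j x) =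
      if i = j then 1 else 0 := by
    intro i j
    rw [← star_dotProduct_eq_subtype p (hsupp j), hv]
  have h := hAs.sum_exp_neg_mul_rayleigh_le_partitionFn β hw
  refine le_of_eq_of_le ?_ h
  refine sum_congr rfl fun i _ => ?_
  rw [star_dotProduct_mulVec_eq_submatrix p A (hsupp i) (hsupp i)]

/-- **Peierls' inequality in a sector, logarithmic form** (nonempty family).
[cite: Ruelle1969, §2.5–2.6] -/
theorem IsHermitian.log_sum_exp_neg_mul_rayleigh_le_submatrix {A : Matrix m m ℂ}
    (hA : A.IsHermitian) (β : ℝ) {ι : Type*} [Fintype ι] [DecidableEq ι] [Nonempty ι]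
    {v : ι → m → ℂ} (hv : ∀ i j, star (v i) ⬝ᵥ v j = if i = j then 1 else 0)
    (hsupp : ∀ i x, ¬ p x → v i x = 0) :
    Real.log (∑ i, Real.exp (-(β * (star (v i) ⬝ᵥ (A *ᵥ v i)).re))) ≤
      Real.log (partitionFn β (A.submatrix (Subtype.val : Subtype p → m) Subtype.val)).re :=
  Real.log_le_log (sum_pos (fun _ _ => Real.exp_pos _) univ_nonempty)
    (hA.sum_exp_neg_mul_rayleigh_le_partitionFn_submatrix p β hv hsupp)

end Sector

end Matrix
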